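import Literature.Geometry.Kaehler.ComplexTorusHodgeRealEndSemisimple
import Literature.Geometry.Kaehler.ComplexTorusRationalKleimanForms
import Literature.Geometry.Kaehler.ComplexTorusRationalHodgeStructure
import Literature.Geometry.Kaehler.ComplexTorusWeylOperatorRationalLefschetzSummands
import HarnessLib

/-!
# André's Prop. 3.3 / Remarque 1 OVER `ℚ` on a polarised complex torus: the Poincaré transpose `ᵗu` and the involution `u† = *_H ᵗu *_H` preserve
# the RATIONAL operators, so the `ℚ`-algebra `End_{ℚ-HS}(H•(X; ℚ))` of rational operators commuting with the Weil operator is `†`-stable,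
# finite-dimensional over `ℚ`, and SEMISIMPLE; and the trace form `(u, v) ↦ Tr(u v†)` is `ℚ`-VALUED on rational operators and POSITIVE DEFINITE in `ℚ`

Layer `Literature/Geometry/Kaehler`, namespace `Literature.Geometry.Kaehler.ComplexTorus`; lane `lit-hodgefound` (Track 2 foundations library),
prover seat `lit-hodgefound-p35` (generation 52, row g52-#6; sequel of g52-#4 `ComplexTorusPoincareTransposeAndreDagger` (`poincareTranspose`, `andreDagger`), g52-#5
`ComplexTorusHodgeRealEndSemisimple` (`hodgeRealEnd`, positivity kills nil ideals) and of gen-51's `ComplexTorusRationalGradedPoincarePairing` (`B_ℚ`, `rationalEndRestrict`),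
`ComplexTorusRationalKleimanForms` (`*_H ∈ 𝔤𝔩(H•(X; ℚ))`)). ONE DEFINITION WITH BODY (`hodgeRatEnd`) + theorems; no named fact, no instance, no notation; D-0026 net debt `0`.

THE POINT. André's Prop. 3.3 concerns a `ℚ`-ALGEBRA: "La `ℚ`-algèbre `C⁰_mot(X, X)` est semi-simple de dimension finie". On the torus the ambient `ℚ`-algebra is
`End_{ℚ-HS}(H•(X; ℚ))` — the `ℂ`-linear operators on `H•(X; ℂ)` preserving the rational classes `H•(X; ℚ) = rationalFormsG Φ` and commuting with the Weil operator —
and the one non-formal input is that André's involution PRESERVES RATIONALITY: `ᵗu` is rational for `u` rational (because `B_ℚ` is a non-degenerate `ℚ`-form of `B_e`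
on the finite-dimensional `H•(X; ℚ)`, §1) and `*_H` is rational for `η ∈ NS(X)` (gen-51). Then row g52-#5's positivity argument applies VERBATIM to every `†`-stable
subalgebra of `End_{ℚ-HS}`, in particular to `End_{ℚ-HS}` itself.

## What is defined / proved

* §0 `moduleFinite_rationalFormsG` — **`H•(X; ℚ)` is finite-dimensional over `ℚ`** (degreewise `monomialBasis`, degrees `> 2g` vanish); `moduleFinite_rationalEnd`;
  `conjG_eq_self_of_mem_rationalFormsG` (rational classes are real), **`conjG_apply_of_mem_rationalEnd`** (rational operators are real).
* §1 **`poincareTranspose_mem_rationalEnd`** — `u ∈ 𝔤𝔩(H•(X; ℚ)) ⟹ ᵗu ∈ 𝔤𝔩(H•(X; ℚ))`; `IsNSForm.andreDagger_mem_rationalEnd` — `u† ∈ 𝔤𝔩(H•(X; ℚ))` (`η ∈ NS(X)`).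
* §2 **def `hodgeRatEnd Φ : Subalgebra ℚ (Module.End ℂ (GForm E ℂ))`** — `End_{ℚ-HS}(H•(X; ℚ))`: rational operators commuting with `C`; `mem_hodgeRatEnd_iff`,
  **`mem_hodgeRealEnd_of_mem_hodgeRatEnd`** (`End_{ℚ-HS} ⊆ End_{ℝ-HS}`), members `lefschetzG`/`lefschetzDualG`/`weylOperator`/`andreHodgeInvolution` (`η ∈ NS(X)`),
  `poincareTranspose_mem_hodgeRatEnd`, **`IsNSForm.andreDagger_mem_hodgeRatEnd`** («stable par ′»); `moduleFinite_hodgeRatEnd` ("de dimension finie"), `isArtinianRing_hodgeRatEnd`.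
* §3 **`IsNSForm.eq_zero_of_mem_nil_rightIdeal_of_andreDagger_mem_rat`** (Remarque 1 for `†`-stable `S ⊆ End_{ℚ-HS}`), **`jacobson_hodgeRatEnd_eq_bot`**,
  **`isSemisimpleRing_hodgeRatEnd`** (`η` a Kähler datum in `NS(X)`, `e : Fin (2g) ≃ ι`), `IsRiemannForm.isSemisimpleRing_hodgeRatEnd`.
* §4 `trace_eq_sum_trace_proj_comp_comp_single` (`Tr = Σ_m Tr` of diagonal blocks), **`exists_ratCast_eq_trace_of_mem_rationalEnd`** (`Tr T ∈ ℚ` for rational `T`),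
  **`IsNSForm.exists_ratCast_eq_trace_mul_andreDagger`** ("à valeurs dans `ℚ`": `Tr(u v†) ∈ ℚ`), **`IsNSForm.exists_pos_ratCast_eq_trace_mul_andreDagger_self`** ("définie positive",
  in `ℚ`: `Tr(u u†) = q > 0`, `q ∈ ℚ`, for `u ≠ 0` in `End_{ℚ-HS}`).

## Sources, VERBATIM

* Y. André, *Pour une théorie inconditionnelle des motifs*, Publ. Math. IHÉS **83** (1996) [Andre1996Motifs], held `paper:doi-10-1007-bf02698643`: Prop. 3.3 (p. 21 =
  chunk p0018 L33–L38) "La `ℚ`-algèbre `C⁰_mot(X, X)` est semi-simple de dimension finie. De plus, la forme bilinéaire symétrique […] `(u, v) ↦ Tr_{H(X)}(u *_H ᵗv *_H)` est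
  à valeurs dans `ℚ`, et définie positive"; Prop. 2.3 (p. 16) "`ℚ`-algèbre graduée […] stable par transposition"; Appendice Remarque 1 (pp. 46–47 = chunks p0043/p0044).
* E. Looijenga, V. Lunts, *A Lie algebra attached to a projective variety*, Invent. Math. **129** (1997) [LooijengaLunts1997], §1 (1.7) (rational structure `H•(X; ℚ)`,
  "defined over `ℚ`").
* H. Lange, *Abelian Varieties over the Complex Numbers* (2023) [Lange2023AbelianVarietiesComplex], §1.1.4 Prop. 1.1.20 (rational classes / lattice monomials), §6.2.4.
* I. N. Herstein, *Noncommutative Rings* [Herstein1994], Thm. 1.3.1, §1.4.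
* N. Bourbaki, *Algebra I* [BourbakiAlgebraI1989], Ch. II §4 no. 3 (trace of an endomorphism of a finite direct sum).
-/

noncomputable section

namespace Literature.Geometry.Kaehler

namespace ComplexTorus

open Module Function Finset
open Literature.LinearAlgebra.Alternating Literature.Algebra.Lie Literature.Analysis.Complex

set_option maxSynthPendingDepth 3
-- As in `ComplexTorusHodgeRealEndSemisimple`: type-class problems over subtype rings of `Module.End ℂ (GForm E ℂ)` need a larger `synthInstance` budget.
set_option synthInstance.maxHeartbeats 400000

universe uE

variable {ι : Type*} [Fintype ι] [DecidableEq ι] {E : Type uE} [NormedAddCommGroup E] [NormedSpace ℂ E] [FiniteDimensional ℂ E]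
  (Φ : (ι → ℝ) ≃L[ℝ] E) {η : E [⋀^Fin 2]→L[ℝ] ℝ} {N : ℕ}

/-! ## §0 `H•(X; ℚ)` is finite-dimensional; rational operators are real -/

section Finite

omit [DecidableEq ι] in
/-- **`H•(X; ℚ) = ⊕_{m ≤ 2g} Hᵐ(X; ℚ)` is finite-dimensional over `ℚ`** (each `Hᵐ(X; ℚ)` has the finite basis of lattice monomials and the degrees `m > 2g = dim_ℝ E`
vanish). [cite: Lange2023AbelianVarietiesComplex, §1.1.4 Prop. 1.1.20] [cite: LooijengaLunts1997, §1 (1.7)] -/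
theorem moduleFinite_rationalFormsG : Module.Finite ℚ (rationalFormsG Φ) := by
  classical
  letI : LinearOrder ι := LinearOrder.lift' (Fintype.equivFin ι) (Fintype.equivFin ι).injective
  haveI : ∀ m : Fin (2 * finrank ℂ E + 1), Module.Finite ℚ (rationalForms Φ (m : ℕ)) := fun m ↦ Module.Finite.of_basis (monomialBasis Φ (m : ℕ))
  let π : rationalFormsG Φ →ₗ[ℚ] ((m : Fin (2 * finrank ℂ E + 1)) → rationalForms Φ (m : ℕ)) :=
    LinearMap.pi fun m ↦
      { toFun := fun w ↦ ⟨(w : GForm E ℂ) m, (mem_rationalFormsG_iff Φ).1 w.2 m⟩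
        map_add' := fun _ _ ↦ Subtype.ext rfl
        map_smul' := fun _ _ ↦ Subtype.ext rfl }
  refine Module.Finite.of_injective π fun w w' hww' ↦ Subtype.ext (funext fun m ↦ ?_)
  by_cases hm : m < 2 * finrank ℂ E + 1
  · exact congrArg Subtype.val (congr_fun hww' ⟨m, hm⟩)
  · rw [eq_zero_of_finrank_real_lt ((w : GForm E ℂ) m) (by rw [finrank_real_of_complex]; omega),
      eq_zero_of_finrank_real_lt ((w' : GForm E ℂ) m) (by rw [finrank_real_of_complex]; omega)]

omit [DecidableEq ι] in
/-- **`𝔤𝔩(H•(X; ℚ)) = rationalEnd Φ` is finite-dimensional over `ℚ`** (it embeds in `End_ℚ H•(X; ℚ)` by restriction). [cite: LooijengaLunts1997, §1 (1.7)] -/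
theorem moduleFinite_rationalEnd : Module.Finite ℚ (rationalEnd Φ) := by
  haveI := moduleFinite_rationalFormsG Φ
  exact Module.Finite.of_injective (rationalEndRestrict Φ).toLinearMap (rationalEndRestrict_injective Φ)

omit [DecidableEq ι] [FiniteDimensional ℂ E] in
/-- **Rational classes are real**: `w̄ = w` for `w ∈ H•(X; ℚ)`. [cite: Lange2023AbelianVarietiesComplex, §1.1.4 Prop. 1.1.20] -/
theorem conjG_eq_self_of_mem_rationalFormsG {w : GForm E ℂ} (hw : w ∈ rationalFormsG Φ) : GForm.conjG w = w :=
  funext fun m ↦ conjForm_eq_self_of_mem_rationalForms Φ ((mem_rationalFormsG_iff Φ).1 hw m)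

omit [DecidableEq ι] in
/-- **Rational operators are real**: `u ∈ 𝔤𝔩(H•(X; ℚ))` commutes with complex conjugation (both `x ↦ \overline{u x̄}` and `u` are `ℂ`-linear and agree on the spanning
`H•(X; ℚ)`). [cite: LooijengaLunts1997, §1 (1.7)] [cite: Lange2023AbelianVarietiesComplex, §1.1.3 Cor. 1.1.19] -/
theorem conjG_apply_of_mem_rationalEnd {T : Module.End ℂ (GForm E ℂ)} (hT : T ∈ rationalEnd Φ) (x : GForm E ℂ) : GForm.conjG (T x) = T (GForm.conjG x) := by
  let S : Module.End ℂ (GForm E ℂ) :=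
    { toFun := fun x ↦ GForm.conjG (T (GForm.conjG x))
      map_add' := fun x y ↦ by rw [GForm.conjG_add, map_add, GForm.conjG_add]
      map_smul' := fun c x ↦ by rw [GForm.conjG_smul, map_smul, GForm.conjG_smul, starRingEnd_self_apply, RingHom.id_apply] }
  have hS : S = T := by
    refine LinearMap.ext_on (span_complex_rationalFormsG_eq_top Φ) fun w hw ↦ ?_
    show GForm.conjG (T (GForm.conjG w)) = T w
    rw [conjG_eq_self_of_mem_rationalFormsG Φ hw, conjG_eq_self_of_mem_rationalFormsG Φ (hT w hw)]
  have h := LinearMap.congr_fun hS (GForm.conjG x)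
  rw [← h]
  show GForm.conjG (T x) = GForm.conjG (T (GForm.conjG (GForm.conjG x)))
  rw [GForm.conjG_conjG]

end Finite

/-! ## §1 The Poincaré transpose and André's involution preserve the rational operators -/

section Rational

/-- **`ᵗu ∈ 𝔤𝔩(H•(X; ℚ))` for `u ∈ 𝔤𝔩(H•(X; ℚ))`** ("stable par transposition"): for rational `w`, the `ℚ`-transpose of `u|_{H•(X; ℚ)}` for the non-degenerate
`ℚ`-form `B_ℚ` on the finite-dimensional `H•(X; ℚ)` supplies a RATIONAL `y` with `B_e(x, y) = B_e(u x, w)` for rational `x`, hence (complex span) for all `x`, and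
`B_e` non-degenerate forces `ᵗu w = y`. [cite: Andre1996Motifs, Prop. 2.3 (p. 16), Prop. 3.3 (p. 21)] [cite: LooijengaLunts1997, §1 (1.7)] -/
theorem poincareTranspose_mem_rationalEnd (e : Fin N ≃ ι) {T : Module.End ℂ (GForm E ℂ)} (hT : T ∈ rationalEnd Φ) : poincareTranspose Φ e T ∈ rationalEnd Φ := by
  classical
  haveI := moduleFinite_rationalFormsG Φ
  intro w hw
  set Tq : Module.End ℚ (rationalFormsG Φ) := rationalEndRestrict Φ ⟨T, hT⟩ with hTq
  set Tq' : Module.End ℚ (rationalFormsG Φ) :=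
    (poincarePairingGRat Φ e).flip.leftAdjointOfNondegenerate (poincarePairingGRat_nondegenerate Φ e).flip Tq with hTq'
  have hadjq : ∀ x y : rationalFormsG Φ, poincarePairingGRat Φ e (Tq x) y = poincarePairingGRat Φ e x (Tq' y) := fun x y ↦
    ((poincarePairingGRat Φ e).flip.isAdjointPairLeftAdjointOfNondegenerate (poincarePairingGRat_nondegenerate Φ e).flip Tq y x).symm
  suffices h : poincareTranspose Φ e T w = (Tq' ⟨w, hw⟩ : GForm E ℂ) by rw [h]; exact (Tq' ⟨w, hw⟩).2
  obtain ⟨-, hr⟩ := poincarePairingG_nondegenerate Φ e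
  rw [← sub_eq_zero]
  refine hr _ fun x ↦ ?_
  rw [map_sub, sub_eq_zero]
  have key : (poincarePairingG Φ e).flip (poincareTranspose Φ e T w) = (poincarePairingG Φ e).flip (Tq' ⟨w, hw⟩ : GForm E ℂ) := by
    refine LinearMap.ext_on (span_complex_rationalFormsG_eq_top Φ) fun x hx ↦ ?_
    show poincarePairingG Φ e x (poincareTranspose Φ e T w) = poincarePairingG Φ e x (Tq' ⟨w, hw⟩ : GForm E ℂ)
    have h1 := coe_poincarePairingGRat Φ e ⟨x, hx⟩ (Tq' ⟨w, hw⟩)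
    have h2 := coe_poincarePairingGRat Φ e (Tq ⟨x, hx⟩) ⟨w, hw⟩
    rw [← hadjq] at h1
    rw [← isAdjointPair_poincareTranspose Φ e T x w, ← h1, h2, coe_rationalEndRestrict_apply]
  exact LinearMap.congr_fun key x

variable [Nontrivial E]

/-- **`u† = *_H ᵗu *_H ∈ 𝔤𝔩(H•(X; ℚ))` for `u ∈ 𝔤𝔩(H•(X; ℚ))`**, `η ∈ NS(X)` non-degenerate (`*_H` is rational, gen-51). [cite: Andre1996Motifs, Prop. 3.3 (p. 21), Appendice Remarque 1 (p. 47)] -/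
theorem IsNSForm.andreDagger_mem_rationalEnd (hNS : IsNSForm Φ η) (hη : ∀ v : E, v ≠ 0 → ∃ w : E, η ![v, w] ≠ 0) (e : Fin N ≃ ι) {T : Module.End ℂ (GForm E ℂ)}
    (hT : T ∈ rationalEnd Φ) : andreDagger Φ hη e T ∈ rationalEnd Φ :=
  (rationalEnd Φ).mul_mem ((rationalEnd Φ).mul_mem (hNS.andreHodgeInvolution_mem_rationalEnd Φ hη) (poincareTranspose_mem_rationalEnd Φ e hT))
    (hNS.andreHodgeInvolution_mem_rationalEnd Φ hη)

end Rational

/-! ## §2 The `ℚ`-algebra `End_{ℚ-HS}(H•(X; ℚ))` -/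

section RatEnd

/-- **`End_{ℚ-HS}(H•(X; ℚ))`, the `ℚ`-algebra of endomorphisms of the rational Hodge structure `H•(X; ℚ) = ⊕ₖ Hᵏ(X; ℚ)`**, realised inside `End_ℂ H•(X; ℂ)`: the
operators preserving the rational classes `rationalFormsG Φ` (LL's `𝔤𝔩(H•(X; ℚ))`) and commuting with the Weil operator `C = (e^{iπ/2})^*` (equivalently, preserving
every Hodge decomposition) — André's `End M` for `M = ⊕ₖ hᵏ(X)` realised in Betti cohomology. [cite: Andre1996Motifs, Appendice Remarque 1 (p. 47), §4 (p. 23)]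
[cite: LooijengaLunts1997, §1 (1.7)] -/
def hodgeRatEnd : Subalgebra ℚ (Module.End ℂ (GForm E ℂ)) where
  carrier := {u | u ∈ rationalEnd Φ ∧ Commute (rotG E (Real.pi / 2)) u}
  mul_mem' hu hv := ⟨(rationalEnd Φ).mul_mem hu.1 hv.1, hu.2.mul_right hv.2⟩
  one_mem' := ⟨(rationalEnd Φ).one_mem, Commute.one_right _⟩
  add_mem' hu hv := ⟨(rationalEnd Φ).add_mem hu.1 hv.1, hu.2.add_right hv.2⟩
  zero_mem' := ⟨(rationalEnd Φ).zero_mem, Commute.zero_right _⟩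
  algebraMap_mem' q := ⟨(rationalEnd Φ).algebraMap_mem q, Algebra.commute_algebraMap_right q _⟩

omit [Fintype ι] [DecidableEq ι] [FiniteDimensional ℂ E] in
/-- Membership: `u ∈ End_{ℚ-HS}` iff `u` is rational and commutes with `C`. [cite: LooijengaLunts1997, §1 (1.7)] -/
theorem mem_hodgeRatEnd_iff (u : Module.End ℂ (GForm E ℂ)) : u ∈ hodgeRatEnd Φ ↔ u ∈ rationalEnd Φ ∧ Commute (rotG E (Real.pi / 2)) u := Iff.rfl

omit [DecidableEq ι] in
/-- **`End_{ℚ-HS}(H•(X; ℚ)) ⊆ End_{ℝ-HS}(H•(X; ℝ))`** (rational operators are real). [cite: LooijengaLunts1997, §1 (1.7)] -/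
theorem mem_hodgeRealEnd_of_mem_hodgeRatEnd {u : Module.End ℂ (GForm E ℂ)} (hu : u ∈ hodgeRatEnd Φ) : u ∈ hodgeRealEnd E :=
  ⟨conjG_apply_of_mem_rationalEnd Φ hu.1, hu.2⟩

/-- **`ᵗu ∈ End_{ℚ-HS}` for `u ∈ End_{ℚ-HS}`** ("stable par transposition"). [cite: Andre1996Motifs, Prop. 2.3 (p. 16)] -/
theorem poincareTranspose_mem_hodgeRatEnd (e : Fin N ≃ ι) {u : Module.End ℂ (GForm E ℂ)} (hu : u ∈ hodgeRatEnd Φ) : poincareTranspose Φ e u ∈ hodgeRatEnd Φ :=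
  ⟨poincareTranspose_mem_rationalEnd Φ e hu.1, commute_rotG_pi_div_two_poincareTranspose Φ e hu.2⟩

variable [Nontrivial E]

omit [Fintype ι] [DecidableEq ι] [FiniteDimensional ℂ E] [Nontrivial E] in
/-- **`L_η ∈ End_{ℚ-HS}`** for `η ∈ NS(X)` (rational, type `(1,1)`). [cite: Andre1996Motifs, §1.1 (p. 10), Prop. 1.2 (p. 11)] -/
theorem IsNSForm.lefschetzG_mem_hodgeRatEnd (hNS : IsNSForm Φ η) : (lefschetzG η : Module.End ℂ (GForm E ℂ)) ∈ hodgeRatEnd Φ :=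
  ⟨lefschetzG_mem_rationalEnd Φ (ofRealForm_mem_rationalForms_of_mem_neronSeveriQ Φ (mem_neronSeveriQ_of_isNSForm Φ hNS)), (lefschetzG_mem_hodgeRealEnd hNS.type_one_one).2⟩

/-- **`Λ_η ∈ End_{ℚ-HS}`** for `η ∈ NS(X)` non-degenerate. [cite: Andre1996Motifs, §1.1 (p. 10), Prop. 1.2 (p. 11)] -/
theorem IsNSForm.lefschetzDualG_mem_hodgeRatEnd (hNS : IsNSForm Φ η) (hη : ∀ v : E, v ≠ 0 → ∃ w : E, η ![v, w] ≠ 0) :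
    (lefschetzDualG η : Module.End ℂ (GForm E ℂ)) ∈ hodgeRatEnd Φ :=
  ⟨lefschetzDualG_mem_rationalEnd Φ (mem_neronSeveriQ_of_isNSForm Φ hNS) hη, (lefschetzDualG_mem_hodgeRealEnd hNS.type_one_one hη).2⟩

/-- **The Weyl operator `w ∈ End_{ℚ-HS}`** (`η ∈ NS(X)` non-degenerate). [cite: Andre1996Motifs, §1.2 (p. 11)] -/
theorem IsNSForm.weylOperator_mem_hodgeRatEnd (hNS : IsNSForm Φ η) (hη : ∀ v : E, v ≠ 0 → ∃ w : E, η ![v, w] ≠ 0) :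
    (hasLefschetzProperty_lefschetzG hη).weylOperator isZGrading_countingG ∈ hodgeRatEnd Φ :=
  ⟨weylOperator_mem_rationalEnd Φ (mem_neronSeveriQ_of_isNSForm Φ hNS) hη, (weylOperator_mem_hodgeRealEnd hNS.type_one_one hη).2⟩

/-- **André's `*_H ∈ End_{ℚ-HS}`** (`η ∈ NS(X)` non-degenerate, normalisation `d = g`). [cite: Andre1996Motifs, §1.1 (p. 10), Prop. 1.2 (p. 11)] -/
theorem IsNSForm.andreHodgeInvolution_mem_hodgeRatEnd (hNS : IsNSForm Φ η) (hη : ∀ v : E, v ≠ 0 → ∃ w : E, η ![v, w] ≠ 0) :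
    (hasLefschetzProperty_lefschetzG hη).andreHodgeInvolution isZGrading_countingG (finrank ℂ E) ∈ hodgeRatEnd Φ :=
  ⟨hNS.andreHodgeInvolution_mem_rationalEnd Φ hη, (andreHodgeInvolution_mem_hodgeRealEnd hNS.type_one_one hη).2⟩

/-- **`u† ∈ End_{ℚ-HS}` for `u ∈ End_{ℚ-HS}`** («stable par ′»; `η ∈ NS(X)` non-degenerate). [cite: Andre1996Motifs, Prop. 3.3 (p. 21), Appendice Remarque 1 (p. 47)] -/
theorem IsNSForm.andreDagger_mem_hodgeRatEnd (hNS : IsNSForm Φ η) (hη : ∀ v : E, v ≠ 0 → ∃ w : E, η ![v, w] ≠ 0) (e : Fin N ≃ ι) {u : Module.End ℂ (GForm E ℂ)}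
    (hu : u ∈ hodgeRatEnd Φ) : andreDagger Φ hη e u ∈ hodgeRatEnd Φ :=
  ⟨hNS.andreDagger_mem_rationalEnd Φ hη e hu.1, commute_rotG_pi_div_two_andreDagger Φ hNS.type_one_one hη e hu.2⟩

omit [DecidableEq ι] [Nontrivial E] in
/-- **`End_{ℚ-HS}(H•(X; ℚ))` is finite-dimensional over `ℚ`** ("de dimension finie"). [cite: Andre1996Motifs, Prop. 3.3 (p. 21)] -/
theorem moduleFinite_hodgeRatEnd : Module.Finite ℚ (hodgeRatEnd Φ) := by
  haveI := moduleFinite_rationalEnd Φ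
  have hle : hodgeRatEnd Φ ≤ rationalEnd Φ := fun u hu ↦ hu.1
  exact Module.Finite.of_injective (Subalgebra.inclusion hle).toLinearMap (Subalgebra.inclusion_injective hle)

omit [DecidableEq ι] [Nontrivial E] in
/-- `End_{ℚ-HS}(H•(X; ℚ))` is (left) Artinian. [cite: Herstein1994, Thm. 1.3.1] -/
theorem isArtinianRing_hodgeRatEnd : IsArtinianRing (hodgeRatEnd Φ) :=
  haveI := moduleFinite_hodgeRatEnd Φ
  IsArtinianRing.of_finite ℚ (hodgeRatEnd Φ)

end RatEnd

/-! ## §3 Semisimplicity of `End_{ℚ-HS}(H•(X; ℚ))` and of its `†`-stable subalgebras -/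

section Semisimple

variable [Nontrivial E] (h11 : ∀ u v : E, η ![Complex.I • u, Complex.I • v] = η ![u, v]) (hpos : ∀ u : E, u ≠ 0 → 0 < η ![Complex.I • u, u])
  (hη : ∀ v : E, v ≠ 0 → ∃ w : E, η ![v, w] ≠ 0) {g : ℕ} (e : Fin (2 * g) ≃ ι)

include h11 hpos in
/-- **André 1996, Appendice Remarque 1 for `†`-stable `S ⊆ End_{ℚ-HS}(H•(X; ℚ))`**: a subset `N ⊆ S` with `N · S ⊆ N` consisting of nilpotent operators is `0` (row g52-#5
through `End_{ℚ-HS} ⊆ End_{ℝ-HS}`). [cite: Andre1996Motifs, Appendice Remarque 1 (p. 47)] -/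
theorem eq_zero_of_mem_nil_rightIdeal_of_andreDagger_mem_rat {S N : Set (Module.End ℂ (GForm E ℂ))} (hS : S ⊆ hodgeRatEnd Φ)
    (hSdag : ∀ u ∈ S, andreDagger Φ hη e u ∈ S) (hNS : N ⊆ S) (hN : ∀ n ∈ N, ∀ s ∈ S, n * s ∈ N) (hnil : ∀ n ∈ N, IsNilpotent n)
    {x : Module.End ℂ (GForm E ℂ)} (hx : x ∈ N) : x = 0 :=
  eq_zero_of_mem_nil_rightIdeal_of_andreDagger_mem Φ h11 hpos hη e (fun _ hu ↦ mem_hodgeRealEnd_of_mem_hodgeRatEnd Φ (hS hu)) hSdag hNS hN hnil hx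

include h11 hpos hη e in
/-- **The Jacobson radical of `End_{ℚ-HS}(H•(X; ℚ))` is zero** (`η ∈ NS(X)` a Kähler datum, `e : Fin (2g) ≃ ι`): it is nilpotent (Artinian), and for `x ∈ J`,
`x x† ∈ J` is nilpotent, so `x = 0` by positivity. [cite: Andre1996Motifs, Prop. 3.3 (p. 21), Appendice Remarque 1 (p. 47)] [cite: Herstein1994, Thm. 1.3.1] -/
theorem IsNSForm.jacobson_hodgeRatEnd_eq_bot (hNS : IsNSForm Φ η) : Ring.jacobson (hodgeRatEnd Φ) = ⊥ := by
  haveI := isArtinianRing_hodgeRatEnd Φ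
  have hJ : IsNilpotent (Ideal.jacobson (⊥ : Ideal (hodgeRatEnd Φ))) := IsArtinianRing.isNilpotent_jacobson_bot
  rw [Ideal.jacobson_bot] at hJ
  obtain ⟨n, hn⟩ := hJ
  refine (Submodule.eq_bot_iff _).2 fun x hx ↦ ?_
  have hxs : x * ⟨andreDagger Φ hη e x, hNS.andreDagger_mem_hodgeRatEnd Φ hη e x.2⟩ ∈ Ring.jacobson (hodgeRatEnd Φ) := Ideal.mul_mem_right _ _ hx
  have hxn : (x * ⟨andreDagger Φ hη e x, hNS.andreDagger_mem_hodgeRatEnd Φ hη e x.2⟩) ^ n = 0 := by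
    have h := Ideal.pow_mem_pow hxs n
    rw [hn] at h
    exact (Submodule.mem_bot _).1 h
  refine Subtype.ext (eq_zero_of_isNilpotent_mul_andreDagger Φ h11 hpos hη e (mem_hodgeRealEnd_of_mem_hodgeRatEnd Φ x.2) ⟨n, ?_⟩)
  have h := congrArg Subtype.val hxn
  rw [Subalgebra.coe_pow, Subalgebra.coe_mul] at h
  exact h

include h11 hpos hη e in
/-- **André 1996, Prop. 3.3 (first clause) on a polarised complex torus, OVER `ℚ`: the finite-dimensional `ℚ`-algebra `End_{ℚ-HS}(H•(X; ℚ))` is SEMISIMPLE**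
(`η ∈ NS(X)` of type `(1,1)` with `η(iu, u) > 0`, `e : Fin (2g) ≃ ι`) — "La `ℚ`-algèbre […] est semi-simple de dimension finie", by the positivity of `†`.
[cite: Andre1996Motifs, Prop. 3.3 (p. 21), Appendice Remarque 1 (p. 47)] [cite: Kleiman1968AlgebraicCycles, §3 Thm. 3.11] -/
theorem IsNSForm.isSemisimpleRing_hodgeRatEnd (hNS : IsNSForm Φ η) : IsSemisimpleRing (hodgeRatEnd Φ) := by
  haveI := isArtinianRing_hodgeRatEnd Φ
  exact IsArtinianRing.isSemisimpleRing_iff_jacobson.2 (hNS.jacobson_hodgeRatEnd_eq_bot Φ h11 hpos hη e)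

/-- **Semisimplicity of `End_{ℚ-HS}(H•(X; ℚ))` for a Riemann form.** [cite: Andre1996Motifs, Prop. 3.3 (p. 21)] -/
theorem IsRiemannForm.isSemisimpleRing_hodgeRatEnd (hR : IsRiemannForm Φ η) {g : ℕ} (e : Fin (2 * g) ≃ ι) : IsSemisimpleRing (hodgeRatEnd Φ) :=
  (hR.isNSForm Φ).isSemisimpleRing_hodgeRatEnd Φ hR.1 hR.2.2 (hR.exists_apply_ne_zero Φ) e

end Semisimple

/-! ## §4 "À valeurs dans `ℚ`": the trace form `(u, v) ↦ Tr(u v†)` is `ℚ`-valued on the rational operators, positive in `ℚ` on `End_{ℚ-HS}` -/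

section RationalTrace

omit [DecidableEq ι] [FiniteDimensional ℂ E] in
/-- Base change `ℚ → ℂ` for traces in the monomial bases (the tree's `CorrRing`-file lemma `trace_eq_algebraMap_trace_rat`, restated here to avoid importing the
correspondence ring): if `f` on `Hᵏ(X; ℂ)` restricts to `f₀` on `Hᵏ(X; ℚ)` then `Tr f = Tr f₀`. [cite: Lange2023AbelianVarietiesComplex, §1.1.4 Prop. 1.1.20 and §1.1.3 Cor. 1.1.19] -/
private theorem trace_eq_ratCast_trace₅₈ [LinearOrder ι] {k : ℕ} (f : (E [⋀^Fin k]→L[ℝ] ℂ) →ₗ[ℂ] (E [⋀^Fin k]→L[ℝ] ℂ))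
    (f₀ : rationalForms Φ k →ₗ[ℚ] rationalForms Φ k) (hf : ∀ γ : rationalForms Φ k, (f₀ γ : E [⋀^Fin k]→L[ℝ] ℂ) = f γ) :
    LinearMap.trace ℂ _ f = algebraMap ℚ ℂ (LinearMap.trace ℚ _ f₀) := by
  have hM : LinearMap.toMatrix (latMonomialBasis Φ k) (latMonomialBasis Φ k) f =
      (LinearMap.toMatrix (monomialBasis Φ k) (monomialBasis Φ k) f₀).map (algebraMap ℚ ℂ) := by
    ext w w'
    rw [Matrix.map_apply, LinearMap.toMatrix_apply, LinearMap.toMatrix_apply, eq_ratCast, ratCast_monomialBasis_repr, hf, coe_monomialBasis,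
      latMonomialBasis_apply, latMonomialBasis_repr_eq_apply]
  rw [LinearMap.trace_eq_matrix_trace ℂ (latMonomialBasis Φ k), LinearMap.trace_eq_matrix_trace ℚ (monomialBasis Φ k), hM, AddMonoidHom.map_trace]

omit [DecidableEq ι] in
/-- **The trace on `H•(X; ℂ) = Π_m Hᵐ` is the sum of the traces of the diagonal blocks**: `Tr T = Σ_{m ≤ 2g} Tr(π_m ∘ T ∘ ι_m)` (`Σ_m ι_m π_m = 1`, cyclicity).
[cite: BourbakiAlgebraI1989, Ch. II §4 no. 3] -/
theorem trace_eq_sum_trace_proj_comp_comp_single (T : Module.End ℂ (GForm E ℂ)) :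
    LinearMap.trace ℂ (GForm E ℂ) T = ∑ m ∈ Finset.range (2 * finrank ℂ E + 1),
      LinearMap.trace ℂ (E [⋀^Fin m]→L[ℝ] ℂ) ((LinearMap.proj m).comp (T.comp (LinearMap.single ℂ (fun m : ℕ ↦ E [⋀^Fin m]→L[ℝ] ℂ) m))) := by
  set P : ℕ → Module.End ℂ (GForm E ℂ) := fun m ↦ (LinearMap.single ℂ (fun m : ℕ ↦ E [⋀^Fin m]→L[ℝ] ℂ) m).comp (LinearMap.proj m) with hP
  have hsum : ∑ m ∈ Finset.range (2 * finrank ℂ E + 1), P m = 1 := by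
    refine LinearMap.ext fun w ↦ ?_
    rw [LinearMap.sum_apply, Module.End.one_apply]
    conv_rhs => rw [← sum_range_of_eq w]
    rfl
  conv_lhs => rw [← mul_one T, ← hsum, Finset.mul_sum, map_sum]
  refine Finset.sum_congr rfl fun m hm ↦ ?_
  haveI : Module.Finite ℂ (E [⋀^Fin m]→L[ℝ] ℂ) := finiteDimensional_alt_of_le (E := E) (Nat.lt_succ_iff.mp (Finset.mem_range.1 hm))
  rw [LinearMap.trace_comp_comm']
  rfl

omit [DecidableEq ι] in
/-- **`Tr T ∈ ℚ` for every rational operator `T ∈ 𝔤𝔩(H•(X; ℚ))`** (each diagonal block restricts to `Hᵐ(X; ℚ)`, whose lattice-monomial `ℚ`-basis is a `ℂ`-basis of `Hᵐ(X; ℂ)`: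
`trace_eq_algebraMap_trace_rat`). [cite: Andre1996Motifs, Prop. 3.3 (p. 21: "à valeurs dans ℚ")] [cite: LooijengaLunts1997, §1 (1.7)] -/
theorem exists_ratCast_eq_trace_of_mem_rationalEnd {T : Module.End ℂ (GForm E ℂ)} (hT : T ∈ rationalEnd Φ) :
    ∃ q : ℚ, LinearMap.trace ℂ (GForm E ℂ) T = q := by
  classical
  letI : LinearOrder ι := LinearOrder.lift' (Fintype.equivFin ι) (Fintype.equivFin ι).injective
  have hblock : ∀ m : ℕ, ∃ q : ℚ,
      LinearMap.trace ℂ (E [⋀^Fin m]→L[ℝ] ℂ) ((LinearMap.proj m).comp (T.comp (LinearMap.single ℂ (fun m : ℕ ↦ E [⋀^Fin m]→L[ℝ] ℂ) m))) = q := by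
    intro m
    set f : (E [⋀^Fin m]→L[ℝ] ℂ) →ₗ[ℂ] (E [⋀^Fin m]→L[ℝ] ℂ) := (LinearMap.proj m).comp (T.comp (LinearMap.single ℂ (fun m : ℕ ↦ E [⋀^Fin m]→L[ℝ] ℂ) m))
      with hf
    have hmem : ∀ x ∈ rationalForms Φ m, f x ∈ rationalForms Φ m := fun x hx ↦ by
      have h1 : T (GForm.of m x) ∈ rationalFormsG Φ := hT _ (of_mem_rationalFormsG Φ hx)
      exact (mem_rationalFormsG_iff Φ).1 h1 m
    let f₀ : rationalForms Φ m →ₗ[ℚ] rationalForms Φ m := (f.restrictScalars ℚ).restrict fun x hx ↦ hmem x hx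
    exact ⟨LinearMap.trace ℚ _ f₀, by rw [trace_eq_ratCast_trace₅₈ Φ f f₀ fun _ ↦ rfl, eq_ratCast]⟩
  choose q hq using hblock
  refine ⟨∑ m ∈ Finset.range (2 * finrank ℂ E + 1), q m, ?_⟩
  rw [trace_eq_sum_trace_proj_comp_comp_single, Rat.cast_sum]
  exact Finset.sum_congr rfl fun m _ ↦ hq m

variable [Nontrivial E]

/-- **André's Prop. 3.3, "à valeurs dans `ℚ`", on the torus: `Tr(u ∘ v†) ∈ ℚ` for rational operators `u, v`** (`η ∈ NS(X)` non-degenerate: `v† = *_H ᵗv *_H` is rational).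
[cite: Andre1996Motifs, Prop. 3.3 (p. 21)] -/
theorem IsNSForm.exists_ratCast_eq_trace_mul_andreDagger (hNS : IsNSForm Φ η) (hη : ∀ v : E, v ≠ 0 → ∃ w : E, η ![v, w] ≠ 0) (e : Fin N ≃ ι)
    {u v : Module.End ℂ (GForm E ℂ)} (hu : u ∈ rationalEnd Φ) (hv : v ∈ rationalEnd Φ) :
    ∃ q : ℚ, LinearMap.trace ℂ (GForm E ℂ) (u * andreDagger Φ hη e v) = q :=
  exists_ratCast_eq_trace_of_mem_rationalEnd Φ ((rationalEnd Φ).mul_mem hu (hNS.andreDagger_mem_rationalEnd Φ hη e hv))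

/-- **… "et définie positive", IN `ℚ`: `Tr(u ∘ u†) = q` with `q ∈ ℚ`, `q > 0`, for every non-zero `u ∈ End_{ℚ-HS}(H•(X; ℚ))`** (`η ∈ NS(X)` with `η(iu, u) > 0`,
`e : Fin (2g) ≃ ι`). [cite: Andre1996Motifs, Prop. 3.3 (p. 21)] [cite: Kleiman1968AlgebraicCycles, §3 Thm. 3.11] -/
theorem IsNSForm.exists_pos_ratCast_eq_trace_mul_andreDagger_self (hNS : IsNSForm Φ η) (hpos : ∀ u : E, u ≠ 0 → 0 < η ![Complex.I • u, u])
    (hη : ∀ v : E, v ≠ 0 → ∃ w : E, η ![v, w] ≠ 0) {g : ℕ} (e : Fin (2 * g) ≃ ι) {u : Module.End ℂ (GForm E ℂ)} (hu : u ∈ hodgeRatEnd Φ) (h0 : u ≠ 0) :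
    ∃ q : ℚ, 0 < q ∧ LinearMap.trace ℂ (GForm E ℂ) (u * andreDagger Φ hη e u) = q := by
  obtain ⟨q, hq⟩ := hNS.exists_ratCast_eq_trace_mul_andreDagger Φ hη e hu.1 hu.1
  obtain ⟨c, hc, hcu⟩ := exists_pos_trace_mul_andreDagger Φ hNS.type_one_one hpos hη e hu.2 (conjG_apply_of_mem_rationalEnd Φ hu.1) h0
  refine ⟨q, ?_, hq⟩
  have h : (c : ℂ) = (q : ℂ) := by rw [← hcu, hq]
  have h' : c = (q : ℝ) := by exact_mod_cast h
  exact_mod_cast h' ▸ hc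

end RationalTrace

end ComplexTorus

end Literature.Geometry.Kaehler
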